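import Literature.NumberTheory.EllipticCurves.IwasawaModuleFinitePadicIntProofs
import Literature.NumberTheory.EllipticCurves.IwasawaAlgebraFreeOfCoinvariantsProofs
import Literature.NumberTheory.EllipticCurves.IwasawaAlgebraEisensteinFiniteQuotientProofs
import Literature.NumberTheory.EllipticCurves.IwasawaAlgebraGenericTwistFiniteProofs
import Literature.NumberTheory.IwasawaTheory.FukudaRankJumpAlgebra
import HarnessLib

/-!
# The rank-jump criterion for `μ = 0` on a finitely generated `Λ`-module:
# `#(M/(T^b,p)M) · p^a < #(M/(T^a,p)M) · p^b` for ONE pair `a < b` forces `T^{b-1}M ⊆ pM`, `M/pM` finite, `μ(M) = 0`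

`Proofs`-style file (theorems only: no definition, no named fact, no `sorry`) in topic `NumberTheory/IwasawaTheory`
(namespace `Literature.NumberTheory.IwasawaTheory.IwasawaModuleRankJump`), written by the prover seat `bsd-line-att-p5`
g43 (cell `bsd-f1-sign2`, route `AlignedTransportAtTwo`; `--supports` stmt-BirchSwinnertonDyer-22298, closes nothing; BSD is
not proved by any of this). Companion of `FukudaRankJumpAlgebra` (seat `bsd-line-att-p3` g40), the FINITE-LEVEL lemma behind
the class-group criterion `ClassGroupPRankStableOfRankJumpLt`; here the same «small rank jump» mechanism (Washington §13.3,
Fukuda 1994) is run DIRECTLY on a finitely generated `Λ = ℤ_p⟦T⟧`-module `M` — the shape in which it applies to the Pontryagin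
dual `X` of a Selmer group over a `ℤ_p`-extension, whose quotients `X/(ω_n, p)X` are dual to `Sel_∞^{Γ_n}[p]` (sequel
`IwasawaModuleLambdaLayersOfRankJump`: the `λ`-bound, the layer form with `ω_n = (1+T)^{pⁿ} − 1`, and the converse).

THE CRITERION. For `i : ℕ` put `J_i = (T^i, p) ⊆ Λ` and `Q_i = M/J_iM` (finite: `finite_quotient_span_X_pow_sup_smul_top`).
If `a < b` and `#Q_b · p^a < #Q_a · p^b` — i.e. `dim_{𝔽_p} Q_b − dim_{𝔽_p} Q_a < b − a` — then
* `T^{b-1}M ⊆ pM` (`span_X_pow_smul_top_le_of_card_lt`), hence `J_iM = pM` for all `i ≥ b − 1` and **`M/pM` is finite**,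
  `#(M/pM) = #Q_b` (`smul_top_eq_augIdealP_smul_top_of_card_lt`, `finite_quotient_augIdealP_of_card_lt`,
  `natCard_quotient_augIdealP_eq_of_card_lt`, `natCard_quotient_eq_of_card_lt`);
* hence (tree, `IwasawaModuleFinitePadicInt`) `M` is `Λ`-torsion, **`μ(M) = 0`**, and `M` is finitely generated over `ℤ_p`
  (`isTorsion_of_card_lt`, `muInvariant_eq_zero_of_card_lt`, `moduleFinite_padicInt_of_card_lt`).
PROOF. On the finite `𝔽_p`-space `V = Q_b` multiplication by `T` is nilpotent (`T^b = 0`) and `T^iV = J_iM/J_bM`, so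
`#Q_b = p^{dim T^aV} · #Q_a` and the hypothesis reads `dim T^aV < b − a`; the chain `T^aV ⊋ T^{a+1}V ⊋ ⋯` is strict while
non-zero (`FukudaRankJump.finrank_map_pow_add_le`), so `T^{b-1}V = 0`, i.e. `T^{b-1}M ⊆ pM + T·T^{b-1}M`, and Nakayama
(`T ∈ rad Λ`) gives `T^{b-1}M ⊆ pM`. Also: `(ω_n, p) = (T^{pⁿ}, p)` (`span_omega_sup_augIdealP_eq`, Frobenius in `Λ/p`).

References: [Washington1997] L. Washington, *Introduction to Cyclotomic Fields*, GTM 83, §13.2 (Nakayama; `X/pX` finite vs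
`μ`), §13.3 Lemma 13.18, Prop. 13.22–13.23 (the rank-jump mechanism for `X = Gal(L_∞/K_∞)`); [Fukuda1994] T. Fukuda,
*Remarks on ℤ_p-extensions of number fields*, Proc. Japan Acad. 70 A (1994), Thm. 1; [GreenbergLNM1716] R. Greenberg, LNM
1716 (1999), §1 pp. 60–61; [GreenbergVatsal2000] §2 Prop. (2.8). -/

set_option autoImplicit false

noncomputable section

open scoped Classical TensorProduct

universe u

namespace Literature.NumberTheory.IwasawaTheory.IwasawaModuleRankJump

open PowerSeries Literature.NumberTheory.EllipticCurves Literature.NumberTheory.EllipticCurves.IwasawaAlgebra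
  Literature.NumberTheory.EllipticCurves.IwasawaModuleFinitePadicInt

variable {p : ℕ} [hp : Fact p.Prime]

/-! ## §1 The ideals `J_i = (T^i, p)` of `Λ` -/

section Ideals

variable (p) in
/-- `(T^a, p) = (T^a + p, p)` as ideals of `Λ`. [folklore] -/
private theorem span_X_pow_sup_augIdealP_eq_span_qm_sup (a : ℕ) :
    Ideal.span {(X : IwasawaAlgebra p) ^ a} ⊔ augIdealP p =
      Ideal.span {(X ^ a + C (p : ℤ_[p]) : IwasawaAlgebra p)} ⊔ Ideal.span {C ((p : ℤ_[p]) ^ 1)} := by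
  rw [pow_one]
  have hC : (C (p : ℤ_[p]) : IwasawaAlgebra p) ∈ augIdealP p := Ideal.mem_span_singleton_self _
  apply le_antisymm
  · refine sup_le ?_ (fun x hx ↦ Ideal.mem_sup_right hx)
    rw [Ideal.span_singleton_le_iff_mem]
    have h := Ideal.sub_mem _ (Ideal.mem_sup_left (Ideal.mem_span_singleton_self (X ^ a + C (p : ℤ_[p]))))
      (Ideal.mem_sup_right (S := Ideal.span {(X ^ a + C (p : ℤ_[p]) : IwasawaAlgebra p)}) hC)
    rwa [add_sub_cancel_right] at h
  · refine sup_le ?_ (fun x hx ↦ Ideal.mem_sup_right hx)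
    rw [Ideal.span_singleton_le_iff_mem]
    exact Ideal.add_mem _ (Ideal.mem_sup_left (Ideal.mem_span_singleton_self _)) (Ideal.mem_sup_right hC)

variable (p) in
/-- `Λ/(T^a, p)` is finite for `a ≥ 1` (it has `p^a` elements). [cite: Washington1997, §13.2 (Prop. 13.8)] -/
theorem finite_quotient_span_X_pow_sup_augIdealP {a : ℕ} (ha : 1 ≤ a) :
    Finite (IwasawaAlgebra p ⧸ Ideal.span {(X : IwasawaAlgebra p) ^ a} ⊔ augIdealP p) := by
  rw [span_X_pow_sup_augIdealP_eq_span_qm_sup p a]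
  exact finite_quotient_span_qm_sup_span_C_pow p ha 1

variable (p) in
/-- `J_{a'} ≤ J_a` for `a ≤ a'`. [folklore] -/
private theorem span_X_pow_sup_augIdealP_anti {a a' : ℕ} (h : a ≤ a') :
    Ideal.span {(X : IwasawaAlgebra p) ^ a'} ⊔ augIdealP p ≤ Ideal.span {(X : IwasawaAlgebra p) ^ a} ⊔ augIdealP p :=
  sup_le_sup_right (Ideal.span_singleton_le_span_singleton.mpr (pow_dvd_pow X h)) _

variable (p) in
/-- `(p : Λ)` is not a unit. [folklore] -/
private theorem natCast_mem_nonunits : ((p : ℕ) : IwasawaAlgebra p) ∈ nonunits (IwasawaAlgebra p) := by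
  rw [← map_natCast (C (R := ℤ_[p])), ← IsLocalRing.mem_maximalIdeal]
  exact C_p_mem_maximalIdeal p

variable (p) in
/-- `augIdealP p = (p)` with `p` the natural-number cast. [folklore] -/
private theorem augIdealP_eq_span_natCast :
    augIdealP p = Ideal.span {((p : ℕ) : IwasawaAlgebra p)} := by
  rw [← map_natCast (C (R := ℤ_[p]))]
  rfl

variable (p) in
/-- **`(ω_n, p) = (T^{pⁿ}, p)`**: `ω_n = (1+T)^{pⁿ} − 1 ≡ T^{pⁿ} (mod p)` (Frobenius in `Λ/p = 𝔽_p⟦T⟧`).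
[cite: Washington1997, §13.3 (proof of Lemma 13.18: `ν_n ≡ T^{pⁿ−1} mod p`)] -/
theorem span_omega_sup_augIdealP_eq (n : ℕ) :
    Ideal.span {((1 + X) ^ p ^ n - 1 : IwasawaAlgebra p)} ⊔ augIdealP p =
      Ideal.span {(X : IwasawaAlgebra p) ^ p ^ n} ⊔ augIdealP p := by
  -- `ω_n − T^{pⁿ} ∈ (p)`
  have hmem : ((1 + X) ^ p ^ n - 1 : IwasawaAlgebra p) - X ^ p ^ n ∈ augIdealP p := by
    haveI : CharP (IwasawaAlgebra p ⧸ Ideal.span {((p : ℕ) : IwasawaAlgebra p)}) p :=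
      CharP.quotient (IwasawaAlgebra p) p (natCast_mem_nonunits p)
    rw [augIdealP_eq_span_natCast, ← Ideal.Quotient.eq_zero_iff_mem]
    simp only [map_sub, map_pow, map_add, map_one]
    rw [add_pow_char_pow, one_pow]
    ring
  apply le_antisymm
  · refine sup_le ?_ le_sup_right
    rw [Ideal.span_singleton_le_iff_mem]
    convert Ideal.add_mem _ (Ideal.mem_sup_right hmem) (Ideal.mem_sup_left (Ideal.mem_span_singleton_self _)) using 1
    ring
  · refine sup_le ?_ le_sup_right
    rw [Ideal.span_singleton_le_iff_mem]
    convert Ideal.sub_mem _ (Ideal.mem_sup_left (Ideal.mem_span_singleton_self _)) (Ideal.mem_sup_right hmem) using 1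
    ring

end Ideals

/-! ## §2 The quotients `Q_i = M/(T^i, p)M` -/

section Quotients

variable {M : Type u} [AddCommGroup M] [Module (IwasawaAlgebra p) M]

/-- An ideal kills the quotient `M/IM`. [folklore] -/
private theorem le_annihilator_quotient_smul_top (I : Ideal (IwasawaAlgebra p)) :
    I ≤ Module.annihilator (IwasawaAlgebra p) (M ⧸ I • (⊤ : Submodule (IwasawaAlgebra p) M)) := by
  intro r hr
  rw [Module.mem_annihilator]
  intro x
  induction x using Submodule.Quotient.induction_on with
  | H m =>
    rw [← Submodule.Quotient.mk_smul, Submodule.Quotient.mk_eq_zero]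
    exact Submodule.smul_mem_smul hr Submodule.mem_top

/-- **`Q_a = M/(T^a, p)M` is finite** for `M` finitely generated over `Λ` (a finitely generated module over the finite ring
`Λ/(T^a, p)`; for `a = 0` the quotient is trivial). [cite: Washington1997, §13.2] -/
theorem finite_quotient_span_X_pow_sup_smul_top [Module.Finite (IwasawaAlgebra p) M] (a : ℕ) :
    Finite (M ⧸ (Ideal.span {(X : IwasawaAlgebra p) ^ a} ⊔ augIdealP p) • (⊤ : Submodule (IwasawaAlgebra p) M)) := by
  rcases Nat.eq_zero_or_pos a with rfl | ha
  · have h : (Ideal.span {(X : IwasawaAlgebra p) ^ 0} ⊔ augIdealP p) = ⊤ := by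
      rw [pow_zero, Ideal.span_singleton_one, top_sup_eq]
    rw [h, Submodule.top_smul]
    infer_instance
  · haveI := finite_quotient_span_X_pow_sup_augIdealP p ha
    exact IwasawaAlgebra.finite_of_finite_quotient_of_le_annihilator p _ (le_annihilator_quotient_smul_top _)

/-- `p` kills `Q_a`. [folklore] -/
private theorem natCast_smul_quotient_eq_zero (I : Ideal (IwasawaAlgebra p)) (hI : augIdealP p ≤ I)
    (x : M ⧸ I • (⊤ : Submodule (IwasawaAlgebra p) M)) : p • x = 0 := by
  have h := le_annihilator_quotient_smul_top (M := M) I (hI (Ideal.mem_span_singleton_self _))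
  rw [Module.mem_annihilator] at h
  have h2 : (p • x : M ⧸ I • (⊤ : Submodule (IwasawaAlgebra p) M)) = ((p : ℕ) : IwasawaAlgebra p) • x :=
    (Nat.cast_smul_eq_nsmul _ _ _).symm
  rw [h2, ← map_natCast (C (R := ℤ_[p]))]
  exact h x

end Quotients

/-! ## §3 The rank-jump mechanism on the finite `𝔽_p`-space `V = Q_b` -/

section Mechanism

variable {M : Type u} [AddCommGroup M] [Module (IwasawaAlgebra p) M] [Module.Finite (IwasawaAlgebra p) M]

/-- **The rank jump forces `T^{b-1}M ⊆ pM`.** For `a < b` and `#Q_b · p^a < #Q_a · p^b` (`Q_i = M/(T^i, p)M`): on `V = Q_b`,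
an `𝔽_p`-space on which `T` is nilpotent, `#Q_b = p^{dim T^aV} · #Q_a`, so `dim T^aV < b − a`; the chain `T^aV ⊋ T^{a+1}V ⊋ ⋯`
is strict while non-zero, hence `T^{b-1}V = 0`, i.e. `T^{b-1}M ⊆ pM + T^bM`, and Nakayama (`T ∈ rad Λ`) gives `T^{b-1}M ⊆ pM`.
[cite: Washington1997, §13.3 Prop. 13.22–13.23 (the mechanism, for `X = Gal(L_∞/K_∞)`)] [cite: Fukuda1994, Thm. 1 (proof)] -/
theorem span_X_pow_smul_top_le_of_card_lt {a b : ℕ} (hab : a < b)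
    (hlt : Nat.card (M ⧸ (Ideal.span {(X : IwasawaAlgebra p) ^ b} ⊔ augIdealP p) • (⊤ : Submodule (IwasawaAlgebra p) M)) *
        p ^ a <
      Nat.card (M ⧸ (Ideal.span {(X : IwasawaAlgebra p) ^ a} ⊔ augIdealP p) • (⊤ : Submodule (IwasawaAlgebra p) M)) *
        p ^ b) :
    Ideal.span {(X : IwasawaAlgebra p) ^ (b - 1)} • (⊤ : Submodule (IwasawaAlgebra p) M) ≤ augIdealP p • ⊤ := by
  have hpr : p.Prime := hp.out
  set Nb := (Ideal.span {(X : IwasawaAlgebra p) ^ b} ⊔ augIdealP p) • (⊤ : Submodule (IwasawaAlgebra p) M) with hNb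
  set Na := (Ideal.span {(X : IwasawaAlgebra p) ^ a} ⊔ augIdealP p) • (⊤ : Submodule (IwasawaAlgebra p) M) with hNa
  haveI hfinb : Finite (M ⧸ Nb) := finite_quotient_span_X_pow_sup_smul_top b
  haveI hfina : Finite (M ⧸ Na) := finite_quotient_span_X_pow_sup_smul_top a
  -- `V = M/N_b` is an `𝔽_p`-space
  have hpV : ∀ v : M ⧸ Nb, p • v = 0 := natCast_smul_quotient_eq_zero _ le_sup_right
  haveI : Module (ZMod p) (M ⧸ Nb) := AddCommGroup.zmodModule hpV
  haveI : Module.Finite (ZMod p) (M ⧸ Nb) := Module.Finite.of_finite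
  -- `τ` = multiplication by `T`, nilpotent
  set τ : (M ⧸ Nb) →ₗ[ZMod p] (M ⧸ Nb) :=
    (DistribSMul.toAddMonoidHom (M ⧸ Nb) (X : IwasawaAlgebra p)).toZModLinearMap p with hτdef
  have hτ : ∀ v : M ⧸ Nb, τ v = (X : IwasawaAlgebra p) • v := fun v ↦ rfl
  have hτpow : ∀ (i : ℕ) (v : M ⧸ Nb), (τ ^ i) v = (X : IwasawaAlgebra p) ^ i • v := by
    intro i
    induction i with
    | zero => intro v; rw [pow_zero, Module.End.one_apply, pow_zero, one_smul]
    | succ i ih => intro v; rw [pow_succ, Module.End.mul_apply, hτ, ih, smul_smul, ← pow_succ]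
  have hτb : τ ^ b = 0 := by
    refine LinearMap.ext fun v ↦ ?_
    rw [hτpow, LinearMap.zero_apply]
    induction v using Submodule.Quotient.induction_on with
    | H m =>
      rw [← Submodule.Quotient.mk_smul, Submodule.Quotient.mk_eq_zero]
      exact Submodule.smul_mem_smul (Ideal.mem_sup_left (Ideal.mem_span_singleton_self _)) Submodule.mem_top
  -- `T^iV = N_i/N_b` for `i ≤ b`
  have hrange : ∀ i, i ≤ b → ((⊤ : Submodule (ZMod p) (M ⧸ Nb)).map (τ ^ i)).toAddSubgroup =
      (((Ideal.span {(X : IwasawaAlgebra p) ^ i} ⊔ augIdealP p) • (⊤ : Submodule (IwasawaAlgebra p) M)).map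
        Nb.mkQ).toAddSubgroup := by
    intro i _
    ext v
    simp only [Submodule.mem_toAddSubgroup, Submodule.mem_map, Submodule.mem_top, true_and]
    constructor
    · rintro ⟨w, rfl⟩
      induction w using Submodule.Quotient.induction_on with
      | H m =>
        exact ⟨(X : IwasawaAlgebra p) ^ i • m,
          Submodule.smul_mem_smul (Ideal.mem_sup_left (Ideal.mem_span_singleton_self _)) Submodule.mem_top,
          by rw [hτpow, Submodule.mkQ_apply, Submodule.Quotient.mk_smul]⟩
    · rintro ⟨y, hy, rfl⟩
      rw [Submodule.sup_smul] at hy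
      obtain ⟨y1, hy1, y2, hy2, rfl⟩ := Submodule.mem_sup.mp hy
      rw [Submodule.ideal_span_singleton_smul, Submodule.mem_smul_pointwise_iff_exists] at hy1
      obtain ⟨m, -, rfl⟩ := hy1
      refine ⟨Submodule.Quotient.mk m, ?_⟩
      have hy2' : (Submodule.Quotient.mk y2 : M ⧸ Nb) = 0 :=
        (Submodule.Quotient.mk_eq_zero Nb).mpr (Submodule.smul_mono_left le_sup_right hy2)
      rw [hτpow, map_add, Submodule.mkQ_apply, Submodule.mkQ_apply, hy2', add_zero, Submodule.Quotient.mk_smul]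
  -- `#Q_b = #(T^iV) · #Q_i`
  have hcardR : ∀ i, i ≤ b → Nat.card (M ⧸ Nb) =
      Nat.card ((⊤ : Submodule (ZMod p) (M ⧸ Nb)).map (τ ^ i)) *
        Nat.card (M ⧸ (Ideal.span {(X : IwasawaAlgebra p) ^ i} ⊔ augIdealP p) • (⊤ : Submodule (IwasawaAlgebra p) M)) := by
    intro i hi
    set Si := (((Ideal.span {(X : IwasawaAlgebra p) ^ i} ⊔ augIdealP p) • (⊤ : Submodule (IwasawaAlgebra p) M)).map
      Nb.mkQ) with hSi
    have h1 := Submodule.card_eq_card_quotient_mul_card Si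
    have h2 : Nat.card ((⊤ : Submodule (ZMod p) (M ⧸ Nb)).map (τ ^ i)) = Nat.card Si :=
      congrArg (fun H : AddSubgroup (M ⧸ Nb) ↦ Nat.card H) (hrange i hi)
    have h3 : Nat.card ((M ⧸ Nb) ⧸ Si) =
        Nat.card (M ⧸ (Ideal.span {(X : IwasawaAlgebra p) ^ i} ⊔ augIdealP p) • (⊤ : Submodule (IwasawaAlgebra p) M)) :=
      Nat.card_congr (Submodule.quotientQuotientEquivQuotient Nb _
        (Submodule.smul_mono_left (span_X_pow_sup_augIdealP_anti p hi))).toEquiv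
    rw [h1, h2, h3]
  -- `dim T^aV + a < b`
  have hRa_card : Nat.card ((⊤ : Submodule (ZMod p) (M ⧸ Nb)).map (τ ^ a)) =
      p ^ Module.finrank (ZMod p) ((⊤ : Submodule (ZMod p) (M ⧸ Nb)).map (τ ^ a)) := by
    rw [Module.natCard_eq_pow_finrank (K := ZMod p), Nat.card_zmod]
  have hQa_pos : 0 < Nat.card (M ⧸ Na) := Nat.card_pos
  have hfin_lt : Module.finrank (ZMod p) ((⊤ : Submodule (ZMod p) (M ⧸ Nb)).map (τ ^ a)) + a < b := by
    rw [hcardR a hab.le, hRa_card] at hlt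
    have h' : Nat.card (M ⧸ Na) * p ^ (Module.finrank (ZMod p) ((⊤ : Submodule (ZMod p) (M ⧸ Nb)).map (τ ^ a)) + a) <
        Nat.card (M ⧸ Na) * p ^ b := by
      calc Nat.card (M ⧸ Na) * p ^ (Module.finrank (ZMod p) ((⊤ : Submodule (ZMod p) (M ⧸ Nb)).map (τ ^ a)) + a)
          = p ^ Module.finrank (ZMod p) ((⊤ : Submodule (ZMod p) (M ⧸ Nb)).map (τ ^ a)) * Nat.card (M ⧸ Na) * p ^ a := by
            ring
        _ < Nat.card (M ⧸ Na) * p ^ b := hlt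
    exact (Nat.pow_lt_pow_iff_right hpr.one_lt).mp (Nat.lt_of_mul_lt_mul_left h')
  -- the strict chain: `T^{b-1}V = 0`
  have hRb1 : (⊤ : Submodule (ZMod p) (M ⧸ Nb)).map (τ ^ (b - 1)) = ⊥ := by
    by_contra hne
    have hchain : Module.finrank (ZMod p) ((⊤ : Submodule (ZMod p) (M ⧸ Nb)).map (τ ^ (b - 1))) + (b - 1 - a) ≤
        Module.finrank (ZMod p) ((⊤ : Submodule (ZMod p) (M ⧸ Nb)).map (τ ^ a)) :=
      FukudaRankJump.finrank_map_pow_add_le τ hτb (W := ⊤) le_top (Nat.le_sub_one_of_lt hab) hne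
    have hba : b - 1 - a + 1 = b - a := by omega
    have h0 : Module.finrank (ZMod p) ((⊤ : Submodule (ZMod p) (M ⧸ Nb)).map (τ ^ (b - 1))) = 0 := by omega
    exact hne (Submodule.finrank_eq_zero.mp h0)
  have hmemNb : ∀ m : M, (X : IwasawaAlgebra p) ^ (b - 1) • m ∈ Nb := by
    intro m
    have h : (τ ^ (b - 1)) (Submodule.Quotient.mk m) ∈ (⊤ : Submodule (ZMod p) (M ⧸ Nb)).map (τ ^ (b - 1)) :=
      Submodule.mem_map_of_mem Submodule.mem_top
    rw [hRb1, Submodule.mem_bot, hτpow, ← Submodule.Quotient.mk_smul, Submodule.Quotient.mk_eq_zero] at h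
    exact h
  -- Nakayama in `M/pM`
  set P : Submodule (IwasawaAlgebra p) M := augIdealP p • ⊤ with hPdef
  set L : Submodule (IwasawaAlgebra p) (M ⧸ P) :=
    (Ideal.span {(X : IwasawaAlgebra p) ^ (b - 1)} • (⊤ : Submodule (IwasawaAlgebra p) M)).map P.mkQ with hL
  have hgenL : ∀ n : M, P.mkQ ((X : IwasawaAlgebra p) ^ (b - 1) • n) ∈ Ideal.span {(X : IwasawaAlgebra p)} • L := by
    intro n
    have hn := hmemNb n
    rw [hNb, Submodule.sup_smul] at hn
    obtain ⟨y1, hy1, y2, hy2, hy⟩ := Submodule.mem_sup.mp hn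
    rw [Submodule.ideal_span_singleton_smul, Submodule.mem_smul_pointwise_iff_exists] at hy1
    obtain ⟨m', -, rfl⟩ := hy1
    have hy2' : P.mkQ y2 = 0 := (Submodule.Quotient.mk_eq_zero P).mpr hy2
    have hdec : P.mkQ ((X : IwasawaAlgebra p) ^ (b - 1) • n) =
        (X : IwasawaAlgebra p) • P.mkQ ((X : IwasawaAlgebra p) ^ (b - 1) • m') := by
      rw [← hy, map_add, hy2', add_zero, ← map_smul, smul_smul, ← pow_succ', Nat.sub_add_cancel (by omega)]
    rw [hdec, Submodule.ideal_span_singleton_smul, Submodule.mem_smul_pointwise_iff_exists]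
    exact ⟨_, Submodule.mem_map_of_mem
      (Submodule.smul_mem_smul (Ideal.mem_span_singleton_self _) Submodule.mem_top), rfl⟩
  have hLle : L ≤ Ideal.span {(X : IwasawaAlgebra p)} • L := by
    rw [hL, Submodule.map_le_iff_le_comap, Submodule.smul_le]
    intro r hr n _
    obtain ⟨c, rfl⟩ := Ideal.mem_span_singleton'.mp hr
    rw [Submodule.mem_comap, mul_smul, map_smul]
    exact Submodule.smul_mem _ c (hgenL n)
  have hLfg : L.FG := IsNoetherian.noetherian L
  have hL0 : L = ⊥ := Submodule.eq_bot_of_le_smul_of_le_jacobson_bot _ L hLfg hLle span_X_le_jacobson_bot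
  -- conclusion
  rw [Submodule.smul_le]
  intro r hr n _
  obtain ⟨c, rfl⟩ := Ideal.mem_span_singleton'.mp hr
  rw [mul_smul]
  refine Submodule.smul_mem _ c ?_
  have h : P.mkQ ((X : IwasawaAlgebra p) ^ (b - 1) • n) ∈ L :=
    Submodule.mem_map_of_mem (Submodule.smul_mem_smul (Ideal.mem_span_singleton_self _) Submodule.mem_top)
  rw [hL0, Submodule.mem_bot, Submodule.mkQ_apply, Submodule.Quotient.mk_eq_zero] at h
  exact h

end Mechanism

/-! ## §4 Consequences: `M/pM` finite, `Λ`-torsion, `μ = 0`, finitely generated over `ℤ_p` -/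

section Consequences

variable {M : Type u} [AddCommGroup M] [Module (IwasawaAlgebra p) M] [Module.Finite (IwasawaAlgebra p) M]

/-- Under the rank jump at `a < b`: **`(T^i, p)M = pM` for every `i ≥ b − 1`** (in particular `Q_{b-1} = Q_b = M/pM`).
[cite: Washington1997, §13.3 Prop. 13.22–13.23] -/
theorem smul_top_eq_augIdealP_smul_top_of_card_lt {a b : ℕ} (hab : a < b)
    (hlt : Nat.card (M ⧸ (Ideal.span {(X : IwasawaAlgebra p) ^ b} ⊔ augIdealP p) • (⊤ : Submodule (IwasawaAlgebra p) M)) *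
        p ^ a <
      Nat.card (M ⧸ (Ideal.span {(X : IwasawaAlgebra p) ^ a} ⊔ augIdealP p) • (⊤ : Submodule (IwasawaAlgebra p) M)) *
        p ^ b) {i : ℕ} (hi : b - 1 ≤ i) :
    (Ideal.span {(X : IwasawaAlgebra p) ^ i} ⊔ augIdealP p) • (⊤ : Submodule (IwasawaAlgebra p) M) = augIdealP p • ⊤ := by
  have h := span_X_pow_smul_top_le_of_card_lt hab hlt
  rw [Submodule.sup_smul]
  refine sup_eq_right.mpr (le_trans (Submodule.smul_mono_left ?_) h)
  exact Ideal.span_singleton_le_span_singleton.mpr (pow_dvd_pow X hi)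

/-- **`M/pM` is finite** under the rank jump at one pair `a < b`.
[cite: Washington1997, §13.3 Prop. 13.23] [cite: Fukuda1994, Thm. 1] -/
theorem finite_quotient_augIdealP_of_card_lt {a b : ℕ} (hab : a < b)
    (hlt : Nat.card (M ⧸ (Ideal.span {(X : IwasawaAlgebra p) ^ b} ⊔ augIdealP p) • (⊤ : Submodule (IwasawaAlgebra p) M)) *
        p ^ a <
      Nat.card (M ⧸ (Ideal.span {(X : IwasawaAlgebra p) ^ a} ⊔ augIdealP p) • (⊤ : Submodule (IwasawaAlgebra p) M)) *
        p ^ b) :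
    Finite (M ⧸ augIdealP p • (⊤ : Submodule (IwasawaAlgebra p) M)) := by
  rw [← smul_top_eq_augIdealP_smul_top_of_card_lt hab hlt (le_refl (b - 1))]
  exact finite_quotient_span_X_pow_sup_smul_top (b - 1)

/-- **`#(M/pM) = #Q_b`** under the rank jump at `a < b`. [cite: Washington1997, §13.3 Prop. 13.23] -/
theorem natCard_quotient_augIdealP_eq_of_card_lt {a b : ℕ} (hab : a < b)
    (hlt : Nat.card (M ⧸ (Ideal.span {(X : IwasawaAlgebra p) ^ b} ⊔ augIdealP p) • (⊤ : Submodule (IwasawaAlgebra p) M)) *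
        p ^ a <
      Nat.card (M ⧸ (Ideal.span {(X : IwasawaAlgebra p) ^ a} ⊔ augIdealP p) • (⊤ : Submodule (IwasawaAlgebra p) M)) *
        p ^ b) :
    Nat.card (M ⧸ augIdealP p • (⊤ : Submodule (IwasawaAlgebra p) M)) =
      Nat.card (M ⧸ (Ideal.span {(X : IwasawaAlgebra p) ^ b} ⊔ augIdealP p) • (⊤ : Submodule (IwasawaAlgebra p) M)) := by
  rw [smul_top_eq_augIdealP_smul_top_of_card_lt hab hlt (Nat.sub_le b 1)]

/-- **`#Q_i = #Q_b` for every `i ≥ b − 1`** under the rank jump at `a < b` (the ranks are frozen from `b − 1` on).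
[cite: Fukuda1994, Thm. 1 (2)] [cite: Washington1997, §13.3 Prop. 13.23] -/
theorem natCard_quotient_eq_of_card_lt {a b : ℕ} (hab : a < b)
    (hlt : Nat.card (M ⧸ (Ideal.span {(X : IwasawaAlgebra p) ^ b} ⊔ augIdealP p) • (⊤ : Submodule (IwasawaAlgebra p) M)) *
        p ^ a <
      Nat.card (M ⧸ (Ideal.span {(X : IwasawaAlgebra p) ^ a} ⊔ augIdealP p) • (⊤ : Submodule (IwasawaAlgebra p) M)) *
        p ^ b) {i : ℕ} (hi : b - 1 ≤ i) :
    Nat.card (M ⧸ (Ideal.span {(X : IwasawaAlgebra p) ^ i} ⊔ augIdealP p) • (⊤ : Submodule (IwasawaAlgebra p) M)) =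
      Nat.card (M ⧸ (Ideal.span {(X : IwasawaAlgebra p) ^ b} ⊔ augIdealP p) • (⊤ : Submodule (IwasawaAlgebra p) M)) := by
  rw [smul_top_eq_augIdealP_smul_top_of_card_lt hab hlt hi, smul_top_eq_augIdealP_smul_top_of_card_lt hab hlt (Nat.sub_le b 1)]

/-- **`M` is `Λ`-torsion** under the rank jump. [cite: GreenbergLNM1716, §1 p. 61] [cite: Washington1997, §13.3 Prop. 13.23] -/
theorem isTorsion_of_card_lt {a b : ℕ} (hab : a < b)
    (hlt : Nat.card (M ⧸ (Ideal.span {(X : IwasawaAlgebra p) ^ b} ⊔ augIdealP p) • (⊤ : Submodule (IwasawaAlgebra p) M)) *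
        p ^ a <
      Nat.card (M ⧸ (Ideal.span {(X : IwasawaAlgebra p) ^ a} ⊔ augIdealP p) • (⊤ : Submodule (IwasawaAlgebra p) M)) *
        p ^ b) :
    Module.IsTorsion (IwasawaAlgebra p) M :=
  isTorsion_of_finite_quotient_augIdealP p M (finite_quotient_augIdealP_of_card_lt hab hlt)

/-- **`μ(M) = 0` under the rank jump at one pair `a < b`** — the module form of Fukuda's / Washington's small-rank-jump
criterion. [cite: Washington1997, §13.3 Prop. 13.23] [cite: Fukuda1994, Thm. 1] [cite: GreenbergVatsal2000, §2 Prop. (2.8)] -/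
theorem muInvariant_eq_zero_of_card_lt {a b : ℕ} (hab : a < b)
    (hlt : Nat.card (M ⧸ (Ideal.span {(X : IwasawaAlgebra p) ^ b} ⊔ augIdealP p) • (⊤ : Submodule (IwasawaAlgebra p) M)) *
        p ^ a <
      Nat.card (M ⧸ (Ideal.span {(X : IwasawaAlgebra p) ^ a} ⊔ augIdealP p) • (⊤ : Submodule (IwasawaAlgebra p) M)) *
        p ^ b) :
    muInvariant p M = 0 :=
  muInvariant_eq_zero_of_finite_quotient_augIdealP p M (isTorsion_of_card_lt hab hlt)
    (finite_quotient_augIdealP_of_card_lt hab hlt)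

/-- **`M` is finitely generated over `ℤ_p`** under the rank jump. [cite: GreenbergLNM1716, §1 p. 60] [cite: Washington1997, §13.2] -/
theorem moduleFinite_padicInt_of_card_lt {a b : ℕ} (hab : a < b)
    (hlt : Nat.card (M ⧸ (Ideal.span {(X : IwasawaAlgebra p) ^ b} ⊔ augIdealP p) • (⊤ : Submodule (IwasawaAlgebra p) M)) *
        p ^ a <
      Nat.card (M ⧸ (Ideal.span {(X : IwasawaAlgebra p) ^ a} ⊔ augIdealP p) • (⊤ : Submodule (IwasawaAlgebra p) M)) *
        p ^ b) :
    Module.Finite ℤ_[p] (RestrictScalars ℤ_[p] (IwasawaAlgebra p) M) :=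
  moduleFinite_padicInt_of_finite_quotient_augIdealP p M (finite_quotient_augIdealP_of_card_lt hab hlt)

end Consequences

end Literature.NumberTheory.IwasawaTheory.IwasawaModuleRankJump

end
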